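import Summits.QuantumFields.YangMills.Theorems.BalabanUVNodesSpineReadingOfRecord13CoPHKRatioDominationBankedChronoOfRecordWindows

/-!
# N20 (NE7b) ON THE TOWER-FREE ROAD, THE FACE OF RECORD IN THE SHAPE OF [III] THM 1: margins `κ₁, E₀` AND A COUPLING CEILING `γ₀ > 0` from the constants, then — for every carrier
# tuple whose histories of record stay in `]0, γ₀]` and obey (2.7) up to their level — the letters (a), the data and labels (b), the multiplicities (ID) and the cut give
# `RelWeightBound`; the infrared smallness `x₀ ≤ log g⁻²` of ✓`…OfRecordWindows` is no longer displayed (a history in `]0, γ₀]`, `γ₀ ≤ e^{−x₀∕2}`, ends below the threshold)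

Cell `pub-ymgap`, YM-PLAN Track A (HUMAN RULING D-0062); seat `pub-ymgap-dag-n20-d` (R134 (a) N20 NE7b s3), gen 42 — director-ym №374 line (E), road [e] TOWER-FREE of record (№377).
`--kind proof --supports stmt-QuantumFields-27366 --as helper` (K3⁸); COUNT-NEUTRAL; THEOREMS ONLY (0 `def`).  [III] = [Balaban1988Convergent]; [B16] = [LF-II] = [Balaban1989LargeFieldII].
Companions BY NAME: `…BankedChronoOfRecordWindows.exists_margins_irThreshold_relWeightBound_chronoGenealogies_ofRecordWindows` (gen 42, p781954), `B14FlowStep.{log_inv_sq,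
log_inv_sq_mono}`, `Step.InInterval`.

WHY.  ✓p781954 displayed, per level, the infrared smallness `x₀ ≤ log g⁻²` of the final coupling of the history of record, next to the interval hypothesis `g_s ∈ ]0, γ]`, `γ ≤ ½`.  But a
history in `]0, γ]` ENDS in `]0, γ]`, and `log γ⁻² ≥ x₀` as soon as `γ ≤ e^{−x₀∕2}`: the threshold is a CEILING ON THE COUPLINGS, i.e. exactly the form in which [III] Thm 1 (p. 262) and
[B16] Thm 1 (p. 355) state their smallness («g_k, k = 0, …, K contained in an interval ]0, γ], γ sufficiently small»).  So the face's `∃ x₀` becomes `∃ γ₀ > 0` (`γ₀ := min ½ e^{−x₀∕2}`)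
and the per-level infrared binder disappears into `Step.InInterval γ₀ (K₀ + K) (histA₁₃ θ K₀ g₀ K)`.

WHAT IS PROVED (kernel; zero `sorry`).  ★★★ `exists_margins_smallCoupling_relWeightBound_chronoGenealogies_ofRecord` (one composition; `log (e^{−x₀∕2})⁻² = x₀`, `log_inv_sq_mono` twice).

WHAT STAYS DISPLAYED (the census of road [e] at the carriers of record after this file; NOT PRINTED as theorems of [LF-II] for `d = 4`, NOT proved here): (a) the fibrewise letters with
good images and the factor clause in `C₀`'s raw factors ∕ control costs ∕ windows of record of the level-read history (an ESTIMATE; junction NC-NE7b-α UNRULED; `pub-balaban`'s R3′);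
(b) removal maps, fibre injections, slot filing into the boxes, genealogy LABELS (DEFINER, post-campaign per №374); (ID) fibre multiplicities `≤ M^{partnerAges}` and caps; (F) slopes
`β′ K ≥ 0`, `1 + β₀ ≤ L`, the histories of record in `]0, γ₀]` up to the level and (2.7) at `p₀` up to the level (the B14 node's currency; (2.7) ⇐ (2.6) + `SmallnessFor` there); the cut
`j⋆`, `c`; `hP : θ.Provisos₁₃CoPH` (K0⁷); that `C₀, r` are print's constants and the boxes the birth cells is READING (ID).

HONEST FRAMING.  [bookkeeping]: one composition and `log e^{−x₀∕2}`; no estimate.  NOTHING of Bałaban's is asserted; NO weight of Bałaban's is bounded; NE7 ∕ NE7b ∕ NE7c NOT PRINTED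
for `d = 4` ∕ NOT proved; no `Provisos₁₃CoPH` inhabitant claimed (K0⁷ OPEN); K3⁸ untouched; N20 NOT discharged; counts UNMOVED (typed 28∕28 · discharged 8∕27); one finite four-torus
programme at fixed `ε` — NOT ℝ⁴, NOT OS, NOT a mass gap, NOT the Clay problem.  No `def`, no `instance`, no `notation`, no `sorry`; no decl below carries a cite tag.
-/

noncomputable section

open MeasureTheory
open scoped BigOperators
open Finset

namespace YMDAG.UVSplit

open Literature.MathematicalPhysics.QuantumFieldTheory.Balaban1983to89
open Literature.MathematicalPhysics.QuantumFieldTheory.Balaban1983to89.T4Continuum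
open Literature.MathematicalPhysics.QuantumFieldTheory.Balaban1983to89.Node00
open Literature.MathematicalPhysics.QuantumFieldTheory.Balaban1983to89.B15.BasicStep (fibreIntegral)
open T4WeightBudget (RelWeightBound)
open T4PersistenceDictionary (Gen PEv dictW)
open T4BankedInduction (Banking credits lifeCost)
open T4PartnerMultiplicity (partnerAges)
open T4BranchingRecordsGas (relabel shape)
open T4PrintedShapeBanking (Consistent)
open T4CanonicalMenus (Chrono fuel canonFam birthMass birthMass_nonneg)

variable {F : T4Family} {N : ℕ} [NeZero N]

/-! ## §1 The coupling ceiling: the infrared binder folded into `]0, γ₀]` -/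

section Ceiling

open scoped Classical in
/-- ★★★ **THE N20 FACE OF RECORD IN THE SHAPE OF [III] THM 1 — «FOR COUPLINGS IN `]0, γ₀]`»** (✓`…_ofRecordWindows` with the infrared binder folded into a coupling ceiling): for print's
valid constants `C₀` (`a, A₀, μ > 0`), `β₀ ≥ 0`, a window exponent `r` with `r(q′+1) < p₀`, ANY `M ≥ 0` and `η̄₊ > 0` there are margins `κ₁, E₀ ≥ 0` with `L^4·e^{η̄₊−κ₁} < 1` and a
COUPLING CEILING `γ₀ > 0` (explicitly `min ½ e^{−x₀∕2}`, `x₀` the infrared threshold of ✓`…Margins`) — all from `(C₀, L, r, β₀, M, η̄₊)`, BEFORE the rank and the carriers — such that for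
every rank, carrier tuple `(θ, hP, K₀, g₀, os, kr, bd)`, cut, slopes `β′ K ≥ 0`, `1 + β₀ ≤ L`, whenever THE HISTORIES OF RECORD STAY IN `]0, γ₀]` up to their level and obey (2.7) (exponent
`p₀`) up to their level, the caps, the displayed measurability ∕ integrability and, per `(K, t)`, EACH RUN's letters (a), data and labels (b), multiplicities (ID) give
`RelWeightBound 1 … (K ↦ 1 − exp(−S_K))`, `S_K = birthMass C₀·e^{−κ₁}·ℓ^4·ρ^{K − j⋆(K) + 1}∕(1 − ρ)`, `ρ = L^4·e^{η̄₊−κ₁}`.  No threshold, no infrared binder, no window, no cell, no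
`Banking`, no numerics displayed: the interval `]0, γ₀]` ([III] Thm 1 p. 262 ∕ [B16] Thm 1 p. 355 «contained in an interval ]0, γ]») carries them all. [bookkeeping] -/
theorem exists_margins_smallCoupling_relWeightBound_chronoGenealogies_ofRecord {X : Type*} (C₀ : T4PrintedShapeBanking.Consts) (hCv : C₀.Valid) (ha : 0 < C₀.a)
    (hA : 0 < C₀.A₀) (hμ₀ : 0 < C₀.μ) {r : ℕ} {β₀ : ℝ} (hβ : 0 ≤ β₀) (hrq : r * (C₀.q' + 1) < C₀.p₀) {M ηplus : ℝ} (hM : 0 ≤ M) (hη : 0 < ηplus) :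
    ∃ κ₁ E₀ γ₀ : ℝ, 0 ≤ κ₁ ∧ 0 ≤ E₀ ∧ 0 < γ₀ ∧ (F.L : ℝ) ^ 4 * Real.exp (ηplus - κ₁) < 1 ∧
      ∀ {N : ℕ} [NeZero N] (θ : Stage13HParams F N) (hP : θ.Provisos₁₃CoPH F N) (K₀ : ℕ) (g₀ : ℕ → ℝ) (os : List (ULoop F))
      (kr : ℕ → (Σ K, SiteSeqKey F (K₀ + K)) → (Σ K, SiteSeqKey F (K₀ + K))) (bd : ℕ → (Σ K, SiteSeqKey F (K₀ + K)) → Prop) (c : ℝ), 0 < c →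
      ∀ (jstar : ℕ → ℕ), (∀ K, jstar K ≤ K) → (∀ K : ℕ, c * K ≤ ((K - jstar K : ℕ) : ℝ)) →
      ∀ (β' : ℕ → ℝ), (∀ K, 0 ≤ β' K) → 1 + β₀ ≤ (F.L : ℝ) →
        (∀ K, Step.InInterval γ₀ (K₀ + K) (histA₁₃ θ K₀ g₀ K)) → (∀ K, B14.FlowIneq27 (histA₁₃ θ K₀ g₀ K) (β' K) β₀ C₀.p₀ (K₀ + K)) →
      ∀ (Dcap Ncap : ℕ → ℕ),
      (∀ K t s, Measurable fun V => chiSeqOfRecord F N θ.ν θ.τ9.M (histA₁₃ θ K₀ g₀ K) (K₀ + K) (K₀ + K) s V *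
        dressedSlotsOfDatum₉ F N θ.toStage9Params (datumOfRecord₁₃CoPH F N θ hP) g₀ os t (runA₁₃ F K₀ g₀ K) (histA₁₃ θ K₀ g₀ K) (K₀ + K) s V) →
      (∀ K t s, Integrable (fun V => chiSeqOfRecord F N θ.ν θ.τ9.M (histA₁₃ θ K₀ g₀ K) (K₀ + K) (K₀ + K) s V *
        dressedSlotsOfDatum₉ F N θ.toStage9Params (datumOfRecord₁₃CoPH F N θ hP) g₀ os t (runA₁₃ F K₀ g₀ K) (histA₁₃ θ K₀ g₀ K) (K₀ + K) s V)
        (fieldMeasure (F.P (K₀ + K)) (K₀ + K) (SU N))) →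
      (∀ K t s', Measurable fun V => chiSeqOfRecord F N θ.ν θ.τ9.M (histB₁₃ θ K₀ g₀ K) (K₀ + K + 1) (K₀ + K + 1) s' V *
        dressedSlotsOfDatum₉ F N θ.toStage9Params (datumOfRecord₁₃CoPH F N θ hP) g₀ os t (runB₁₃ F K₀ g₀ K) (histB₁₃ θ K₀ g₀ K) (K₀ + K + 1) s' V) →
      (∀ K t s', Integrable (fun V => chiSeqOfRecord F N θ.ν θ.τ9.M (histB₁₃ θ K₀ g₀ K) (K₀ + K + 1) (K₀ + K + 1) s' V *
        dressedSlotsOfDatum₉ F N θ.toStage9Params (datumOfRecord₁₃CoPH F N θ hP) g₀ os t (runB₁₃ F K₀ g₀ K) (histB₁₃ θ K₀ g₀ K) (K₀ + K + 1) s' V)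
        (fieldMeasure (F.P (K₀ + K + 1)) (K₀ + K + 1) (SU N))) →
      (∀ (K : ℕ) (t : ℝ), |t| ≤ 1 →
        ∃ (rm : SeqOfRecord F θ.ν θ.τ9.M (histA₁₃ θ K₀ g₀ K) (K₀ + K) (K₀ + K) → SeqOfRecord F θ.ν θ.τ9.M (histA₁₃ θ K₀ g₀ K) (K₀ + K) (K₀ + K))
          (fib : SeqOfRecord F θ.ν θ.τ9.M (histA₁₃ θ K₀ g₀ K) (K₀ + K) (K₀ + K) → Finset (PBond (F.P (K₀ + K)) (K₀ + K)))
          (z : SeqOfRecord F θ.ν θ.τ9.M (histA₁₃ θ K₀ g₀ K) (K₀ + K) (K₀ + K) → ℝ) (Old : SeqOfRecord F θ.ν θ.τ9.M (histA₁₃ θ K₀ g₀ K) (K₀ + K) (K₀ + K) → Finset X)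
          (φ : SeqOfRecord F θ.ν θ.τ9.M (histA₁₃ θ K₀ g₀ K) (K₀ + K) (K₀ + K) → SeqOfRecord F θ.ν θ.τ9.M (histA₁₃ θ K₀ g₀ K) (K₀ + K) (K₀ + K) → Finset X)
          (slot : X → (Σ _ : ℕ, (Fin 4 → ℕ))) (G : X → Gen PEv),
          (∀ s, kr K (keyA₁₃ θ K₀ g₀ K s) ∈ badClassK₁₃ θ K₀ g₀ kr bd K t → ∀ V,
            fibreIntegral (fib s) (fun V => chiSeqOfRecord F N θ.ν θ.τ9.M (histA₁₃ θ K₀ g₀ K) (K₀ + K) (K₀ + K) s V *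
                dressedSlotsOfDatum₉ F N θ.toStage9Params (datumOfRecord₁₃CoPH F N θ hP) g₀ os t (runA₁₃ F K₀ g₀ K) (histA₁₃ θ K₀ g₀ K) (K₀ + K) s V) V ≤
              z s * fibreIntegral (fib s) (fun V => chiSeqOfRecord F N θ.ν θ.τ9.M (histA₁₃ θ K₀ g₀ K) (K₀ + K) (K₀ + K) (rm s) V *
                dressedSlotsOfDatum₉ F N θ.toStage9Params (datumOfRecord₁₃CoPH F N θ hP) g₀ os t (runA₁₃ F K₀ g₀ K) (histA₁₃ θ K₀ g₀ K) (K₀ + K) (rm s) V) V) ∧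
          (∀ s, kr K (keyA₁₃ θ K₀ g₀ K s) ∈ badClassK₁₃ θ K₀ g₀ kr bd K t → kr K (keyA₁₃ θ K₀ g₀ K (rm s)) ∉ badClassK₁₃ θ K₀ g₀ kr bd K t) ∧
          (∀ σ s, kr K (keyA₁₃ θ K₀ g₀ K s) ∈ badClassK₁₃ θ K₀ g₀ kr bd K t → rm s = σ → φ σ s ⊆ Old σ ∧ (φ σ s).Nonempty) ∧
          (∀ σ, Set.InjOn (φ σ) {s | kr K (keyA₁₃ θ K₀ g₀ K s) ∈ badClassK₁₃ θ K₀ g₀ kr bd K t ∧ rm s = σ}) ∧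
          (∀ σ s, kr K (keyA₁₃ θ K₀ g₀ K s) ∈ badClassK₁₃ θ K₀ g₀ kr bd K t → rm s = σ →
            z s ≤ ∏ Y ∈ φ σ s, Real.exp (-credits (T4PrintedShapeBanking.credit C₀ (fun j => histA₁₃ θ K₀ g₀ K (min j (K₀ + K)))) (G Y)) *
              Real.exp (lifeCost (dictW (fun s => RkOfRecord F.L r (histA₁₃ θ K₀ g₀ K s)) C₀.n₁) (T4PrintedShapeBanking.cost C₀ (K₀ + K) (fun s => RkOfRecord F.L r (histA₁₃ θ K₀ g₀ K s))) (G Y))) ∧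
          (∀ σ, ∀ Y ∈ Old σ, (slot Y).1 < K₀ + jstar K) ∧
          (∀ σ, ∀ Y ∈ Old σ, (slot Y).2 ∈ Fintype.piFinset fun _ : Fin 4 => Finset.range (2 * F.L ^ F.m * F.L ^ ((K₀ + K) - (slot Y).1))) ∧
          (∀ σ, ∀ Y ∈ Old σ, Consistent C₀ (K₀ + K) (fun s => RkOfRecord F.L r (histA₁₃ θ K₀ g₀ K s)) (G Y)) ∧
          (∀ σ, ∀ Y ∈ Old σ, (G Y).WF (dictW (fun s => RkOfRecord F.L r (histA₁₃ θ K₀ g₀ K s)) C₀.n₁)) ∧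
          (∀ σ, ∀ Y ∈ Old σ, K₀ + K < (G Y).reach (dictW (fun s => RkOfRecord F.L r (histA₁₃ θ K₀ g₀ K s)) C₀.n₁)) ∧ (∀ σ, ∀ Y ∈ Old σ, Chrono PEv.step (G Y)) ∧
          (∀ σ, ∀ Y ∈ Old σ, ∀ e ∈ (G Y).events, e.kind = 0 → e.fat < Dcap (K₀ + K)) ∧ (∀ σ, ∀ Y ∈ Old σ, fuel (G Y) ≤ Ncap (K₀ + K)) ∧
          (∀ σ, ∀ Y ∈ Old σ, (G Y).rootStep = (slot Y).1) ∧
          (∀ σ, ∀ j < K₀ + jstar K, ∀ zc ∈ (Fintype.piFinset fun _ : Fin 4 => Finset.range (2 * F.L ^ F.m * F.L ^ ((K₀ + K) - j))),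
            ∀ G₀ ∈ canonFam Dcap Ncap (K₀ + K) j,
            ((((Old σ).filter fun Y => slot Y = ⟨j, zc⟩ ∧ relabel shape (G Y) = G₀).card : ℕ) : ℝ) ≤ M ^ partnerAges PEv.step G₀)) →
      (∀ (K : ℕ) (t : ℝ), |t| ≤ 1 →
        ∃ (rm : SeqOfRecord F θ.ν θ.τ9.M (histB₁₃ θ K₀ g₀ K) (K₀ + K + 1) (K₀ + K + 1) → SeqOfRecord F θ.ν θ.τ9.M (histB₁₃ θ K₀ g₀ K) (K₀ + K + 1) (K₀ + K + 1))
          (fib : SeqOfRecord F θ.ν θ.τ9.M (histB₁₃ θ K₀ g₀ K) (K₀ + K + 1) (K₀ + K + 1) → Finset (PBond (F.P (K₀ + K + 1)) (K₀ + K + 1)))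
          (z : SeqOfRecord F θ.ν θ.τ9.M (histB₁₃ θ K₀ g₀ K) (K₀ + K + 1) (K₀ + K + 1) → ℝ)
          (Old : SeqOfRecord F θ.ν θ.τ9.M (histB₁₃ θ K₀ g₀ K) (K₀ + K + 1) (K₀ + K + 1) → Finset X)
          (φ : SeqOfRecord F θ.ν θ.τ9.M (histB₁₃ θ K₀ g₀ K) (K₀ + K + 1) (K₀ + K + 1) → SeqOfRecord F θ.ν θ.τ9.M (histB₁₃ θ K₀ g₀ K) (K₀ + K + 1) (K₀ + K + 1) → Finset X)
          (slot : X → (Σ _ : ℕ, (Fin 4 → ℕ))) (G : X → Gen PEv),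
          (∀ s', kr K (keyB₁₃ θ K₀ g₀ K s') ∈ badClassK₁₃ θ K₀ g₀ kr bd K t → ∀ V,
            fibreIntegral (fib s') (fun V => chiSeqOfRecord F N θ.ν θ.τ9.M (histB₁₃ θ K₀ g₀ K) (K₀ + K + 1) (K₀ + K + 1) s' V *
                dressedSlotsOfDatum₉ F N θ.toStage9Params (datumOfRecord₁₃CoPH F N θ hP) g₀ os t (runB₁₃ F K₀ g₀ K) (histB₁₃ θ K₀ g₀ K) (K₀ + K + 1) s' V) V ≤
              z s' * fibreIntegral (fib s') (fun V => chiSeqOfRecord F N θ.ν θ.τ9.M (histB₁₃ θ K₀ g₀ K) (K₀ + K + 1) (K₀ + K + 1) (rm s') V *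
                dressedSlotsOfDatum₉ F N θ.toStage9Params (datumOfRecord₁₃CoPH F N θ hP) g₀ os t (runB₁₃ F K₀ g₀ K) (histB₁₃ θ K₀ g₀ K) (K₀ + K + 1) (rm s') V) V) ∧
          (∀ s', kr K (keyB₁₃ θ K₀ g₀ K s') ∈ badClassK₁₃ θ K₀ g₀ kr bd K t → kr K (keyB₁₃ θ K₀ g₀ K (rm s')) ∉ badClassK₁₃ θ K₀ g₀ kr bd K t) ∧
          (∀ σ s', kr K (keyB₁₃ θ K₀ g₀ K s') ∈ badClassK₁₃ θ K₀ g₀ kr bd K t → rm s' = σ → φ σ s' ⊆ Old σ ∧ (φ σ s').Nonempty) ∧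
          (∀ σ, Set.InjOn (φ σ) {s' | kr K (keyB₁₃ θ K₀ g₀ K s') ∈ badClassK₁₃ θ K₀ g₀ kr bd K t ∧ rm s' = σ}) ∧
          (∀ σ s', kr K (keyB₁₃ θ K₀ g₀ K s') ∈ badClassK₁₃ θ K₀ g₀ kr bd K t → rm s' = σ →
            z s' ≤ ∏ Y ∈ φ σ s', Real.exp (-credits (T4PrintedShapeBanking.credit C₀ (fun j => histB₁₃ θ K₀ g₀ K (min j (K₀ + K + 1)))) (G Y)) *
              Real.exp (lifeCost (dictW (fun s => RkOfRecord F.L r (histB₁₃ θ K₀ g₀ K s)) C₀.n₁) (T4PrintedShapeBanking.cost C₀ (K₀ + K + 1) (fun s => RkOfRecord F.L r (histB₁₃ θ K₀ g₀ K s))) (G Y))) ∧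
          (∀ σ, ∀ Y ∈ Old σ, (slot Y).1 < K₀ + jstar K + 1) ∧
          (∀ σ, ∀ Y ∈ Old σ, (slot Y).2 ∈ Fintype.piFinset fun _ : Fin 4 => Finset.range (2 * F.L ^ F.m * F.L ^ ((K₀ + K + 1) - (slot Y).1))) ∧
          (∀ σ, ∀ Y ∈ Old σ, Consistent C₀ (K₀ + K + 1) (fun s => RkOfRecord F.L r (histB₁₃ θ K₀ g₀ K s)) (G Y)) ∧
          (∀ σ, ∀ Y ∈ Old σ, (G Y).WF (dictW (fun s => RkOfRecord F.L r (histB₁₃ θ K₀ g₀ K s)) C₀.n₁)) ∧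
          (∀ σ, ∀ Y ∈ Old σ, K₀ + K + 1 < (G Y).reach (dictW (fun s => RkOfRecord F.L r (histB₁₃ θ K₀ g₀ K s)) C₀.n₁)) ∧ (∀ σ, ∀ Y ∈ Old σ, Chrono PEv.step (G Y)) ∧
          (∀ σ, ∀ Y ∈ Old σ, ∀ e ∈ (G Y).events, e.kind = 0 → e.fat < Dcap (K₀ + K + 1)) ∧ (∀ σ, ∀ Y ∈ Old σ, fuel (G Y) ≤ Ncap (K₀ + K + 1)) ∧
          (∀ σ, ∀ Y ∈ Old σ, (G Y).rootStep = (slot Y).1) ∧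
          (∀ σ, ∀ j < K₀ + jstar K + 1, ∀ zc ∈ (Fintype.piFinset fun _ : Fin 4 => Finset.range (2 * F.L ^ F.m * F.L ^ ((K₀ + K + 1) - j))),
            ∀ G₀ ∈ canonFam Dcap Ncap (K₀ + K + 1) j,
            ((((Old σ).filter fun Y => slot Y = ⟨j, zc⟩ ∧ relabel shape (G Y) = G₀).card : ℕ) : ℝ) ≤ M ^ partnerAges PEv.step G₀)) →
      RelWeightBound 1 (classSetK₁₃ θ K₀ g₀ kr) (weightAK₁₃ θ hP K₀ g₀ os kr) (weightBK₁₃ θ hP K₀ g₀ os kr) (badClassK₁₃ θ K₀ g₀ kr bd)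
        (fun K => 1 - Real.exp (-(birthMass C₀ * Real.exp (-κ₁) * (((2 * F.L ^ F.m : ℕ) : ℝ) ^ 4) *
          ((((F.L : ℝ) ^ 4) * Real.exp (ηplus - κ₁)) ^ (K - jstar K + 1) / (1 - ((F.L : ℝ) ^ 4) * Real.exp (ηplus - κ₁)))))) := by
  obtain ⟨κ₁, E₀, x₀, hκ, hE, hr, hx₀⟩ :=
    exists_margins_irThreshold_relWeightBound_chronoGenealogies_ofRecordWindows (F := F) (X := X) C₀ hCv ha hA hμ₀ hβ hrq hM hη
  -- the coupling ceiling: `γ₀ := min ½ e^{−x₀∕2}`, so that `log γ₀⁻² ≥ x₀`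
  have hγpos : 0 < min (1 / 2 : ℝ) (Real.exp (-(x₀ / 2))) := lt_min (by norm_num) (Real.exp_pos _)
  have hγx : x₀ ≤ Real.log ((min (1 / 2 : ℝ) (Real.exp (-(x₀ / 2)))) ^ 2)⁻¹ := by
    have h1 : Real.log ((Real.exp (-(x₀ / 2))) ^ 2)⁻¹ = x₀ := by
      rw [B14FlowStep.log_inv_sq, Real.log_exp]; ring
    exact h1.symm.le.trans (B14FlowStep.log_inv_sq_mono hγpos (min_le_right _ _))
  refine ⟨κ₁, E₀, min (1 / 2 : ℝ) (Real.exp (-(x₀ / 2))), hκ, hE, hγpos, hr, ?_⟩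
  intro N _ θ hP K₀ g₀ os kr bd c hc jstar hjK hfrac β' hβ' hβL hI h27 Dcap Ncap hmA hintA hmB hintB hLA hLB
  have hxK : ∀ K, x₀ ≤ Real.log ((histA₁₃ θ K₀ g₀ K (K₀ + K)) ^ 2)⁻¹ := fun K =>
    hγx.trans (B14FlowStep.log_inv_sq_mono (hI K (K₀ + K) le_rfl).1 (hI K (K₀ + K) le_rfl).2)
  exact hx₀ θ hP K₀ g₀ os kr bd c hc jstar hjK hfrac (min (1 / 2 : ℝ) (Real.exp (-(x₀ / 2)))) β' (min_le_left _ _) hβ' hβL hI h27 hxK Dcap Ncap hmA hintA hmB hintB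
    hLA hLB

end Ceiling

end YMDAG.UVSplit
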